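import Summits.ResolutionOfSingularities.ResolutionOfSingularities.Theorems.HilbertSamuelEliminationSigmaMaxModificationsCorridor3SigmaTameMidSncRealisation
import HarnessLib

/-!
# [OURS · L1 W4.2] σ-LAYER — `Corridor3SigmaTameSurfaceReading`: THE (G10) READING «`IsTameSurfaceComponent`» = res-D-pv-060's T-M1 FRAME, read for BOTH consumers
# ((G10a) TAME-SURFACE at `S₀ ≥ m`, (MID-α) at `S₀ < m` — RULING v3.14-49 (RB) «ONE notion, two consumers»), the INTRINSIC FORM of the frame residual
# (`N ∈ (w^{S₀}) ∧ N ∉ 𝔪^{S₀+1} ⇒ N = ε·w^{S₀}`, PROVED), and the (G10a) SURFACE STEP = the SINGLETON FACE `{σ}` of the frame: legality `⟺ m ≤ S₀`, its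
# controlled transform `I = w^m · u^{e′}` with the VALUE LAW `e′ = update e σ (S₀ − m)` («`α_E = S₀ − m`», the surface `Σ` becomes the member in slot `σ`, the residual
# becomes a unit ⇒ EXACT) — all by NAME from T-M1 (p560149) at `J = {σ}`, `j₀ = σ`, chart map `= id` (blowing up the Cartier divisor `Σ ⊂ H` changes no ring)
# (crux chain w42 `SigmaMaxModifications` stmt-ResolutionOfSingularities-18506 / conjunct `SigmaMaxModificationsCorridor3` stmt-ResolutionOfSingularities-19249;
# res-L1-w42-plan-1 RULING v3.14-48 (PC)(G10a/b) + (PF) «(G10) reading `IsTameSurfaceComponent` — 067/068 successor», DESK WORD 18:37:40Z (L1)–(L3);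
# seat res-L1-type-o2 g9 = «res-type-067/068 SUCCESSOR»; `--supports stmt-ResolutionOfSingularities-19249 --as helper`, counted 0)

HONEST FRAMING. OURS bookkeeping over res-D-pv-060's `…Corridor3SigmaTameMidSncRealisation` (the frame `IsRsopPart u`, `I = ε·u^e`, the order dictionary
`unit_mul_uPow_mem_pow_span_image_iff`, the chart identity `map_span_singleton_unit_mul_uPow`) and the tree's `IsRsopPart` API. NOTHING here is a statement
of H. Hironaka's manuscript [Hironaka2017] nor of Cossart–Jannsen–Saito / Cossart–Piltant (whose Prop. 2.1/2.6 calculus is the tree's, PROVED). One `structure`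
(the frame reading) + small `def`s; every `theorem` PROVED; no named fact, no axiom, no instance, no notation. AI-typed; AI review weaker than expert review.

## Contents (namespace `…Theorems.SigmaMaxModificationsCorridor3.Sigma.TameSurface`)

* §1 **`TameSurface.Frame R`** — the reading: `u : Fin n → R` with `IsRsopPart u` (ALL members through the point, weight `0` included, AND the surface
  slot `σ`, `w := u σ`, `Σ = V(w)`), the row `e` (`e σ = S₀`, `e j = α_j` on members), the unit `ε`; `Frame.ideal := ε · u^e` (the ideal of record `I = M·N`
  on the contact threefold germ), `Frame.S₀`, `Frame.w`, `Frame.residual := ε · w^{S₀}` (`= N`), `ideal_eq_monomial_mul_residual` (`I = u^{e·𝟙_{≠σ}} · N`);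
  the KIND TESTS `IsSurfaceKind m := m ≤ S₀` ((G10a), TAME-HIGH/SURFACE) and `IsMidAlphaKind m := 1 ≤ S₀ ∧ S₀ < m` ((MID-α)), `kind_trichotomy` (`S₀ = 0` ∨ mid-α ∨ surface).
* §2 **INTRINSIC FORM, PROVED** (RULING -49 (RA)/(RB-1) direction used by the realisation): `exists_isUnit_mul_pow_of_mem_span_pow` — in a local ring, `w ∈ 𝔪`,
  `N ∈ (w^{S})`, `N ∉ 𝔪^{S+1}` ⇒ `N = ε · w^{S}` with `ε` a unit (the cofactor cannot lie in `𝔪`). So «the `S₀`-fold locus of `N` is the regular surface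
  `V(w)` through the point, at which `ord N = S₀`» yields the frame residual; the frame itself (`{w} ∪ u_𝓑` part of ONE r.s.p.) is the n.c. clause (RB-3).
* §3 **(G10a) THE SURFACE STEP** = the singleton face `{σ}`: `ideal_mem_span_w_pow_iff : I ∈ (w)^i ↔ i ≤ S₀` (`V(w) = Σ` lies in `{ord I ≥ i}` iff `i ≤ S₀`;
  with `i = m`: `Σ ⊆ X_max ⟺ IsSurfaceKind m`, the (L1) reading), `surfaceRow m := update e σ (S₀ − m)` with `surfaceRow_σ` / `surfaceRow_of_ne` (VALUE LAW
  `α_Σ = S₀ − m`, members unchanged) and `surfaceRow_eq_move` (it IS T-M1's `update e j₀ (Σ_{j∈J} e_j − m)` at `J = {σ}`, `j₀ = σ`), and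
  **`span_ideal_eq_surfaceStep : (I) = (w^m) · (u^{surfaceRow m})`** for `m ≤ S₀` — T-M1's `map_span_singleton_unit_mul_uPow` with the chart map `RingHom.id`
  (the blow-up of the Cartier divisor `Σ` of the threefold germ is an isomorphism; only the bookkeeping moves: slot `σ` is now the MEMBER `E = Σ` of weight
  `S₀ − m` and the residual is the unit `ε` — `residual_after_surfaceStep`), hence the point is EXACT after the step (`isExactAfter`: the new row has no
  residual slot). (L2) normal flatness and the X-side are 060's `mem_centre_pow_of_le_sum` (T = {σ}) / `isNormallyFlat_of_mul_mem_pow` BY NAME — not restated.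
* §4 **(G10b) READING AXIOM** `IsSurfacePhaseChild F F′` (for the 𝓑-REGULARISATION sub-phase, centres = points / regular curves INSIDE `Σ`, finiteness = the
  IMPORT F-72/F-60, DESK WORD 18:37:40Z): the frame PERSISTS at the lineage child on `Σ′` with the SAME `S₀` ((L3′) S-safety — 060's lemma to cite when it
  lands) and the imported sequence's remaining-centre count drops; `IsSurfacePhaseChild.S₀_eq`, `count_lt`. Values only; o1's `TameSurfacePrescription` and
  the TAME-HIGH fuel's first coordinate consume it.

VACUITY SELF-CHECK. `Frame` is inhabited by any regular local ring with an r.s.p. part and any row/unit; §2/§3 are theorems with content (§2 fails without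
`N ∉ 𝔪^{S+1}`: `N = w^{S+1}`; §3's legality is an `iff`). `IsSurfacePhaseChild` demands a strict drop, false for the identity step.
-/

set_option linter.dupNamespace false -- mandated namespace of this single-conjunct summit

namespace Summit.ResolutionOfSingularities.ResolutionOfSingularities.Theorems.SigmaMaxModificationsCorridor3.Sigma.TameSurface

open Finset IsLocalRing
open Literature.AlgebraicGeometry.Resolution Literature.AlgebraicGeometry.Resolution.CossartPiltant
open Summit.ResolutionOfSingularities.ResolutionOfSingularities.Theorems.SigmaMaxModificationsCorridor3.Sigma.TameMidSnc

universe u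

/-! ## §1. The frame reading -/

/-- [OURS · L1 W4.2] **THE (G10)/(MID-α) FRAME READING `IsTameSurfaceComponent`** at a tame point `x` of the contact threefold germ `R = 𝒪_{H,x}`
(res-D-pv-060's T-M1 frame, bundled): ONE family `u` that is part of a regular system of parameters, listing ALL boundary members through `x` (weight `0`
included, (RB-3)) AND the surface slot `σ` (`w = u σ`, `Σ = V(w)` the regular surface component of the `S₀`-fold locus of the residual), ONE exponent row `e`
(`e σ = S₀`, `e j = α_j` on members) and a unit `ε`, so that the ideal of record is the principal monomial `I = ε · u^e`. Replaces the role of «`Σ_X = V(x, N₁)`,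
`N = N₁^k · N′`» of RULING v3.14-48 (PC)(G10); NOT a statement of the manuscript. [folklore] -/
structure Frame (R : Type u) [CommRing R] [IsLocalRing R] where
  /-- number of slots (members through the point + the surface slot) -/
  n : ℕ
  /-- the frame: members' local equations and `w` -/
  u : Fin n → R
  /-- it is part of a regular system of parameters (snc) -/
  isRsopPart : IsRsopPart u
  /-- the surface slot: `w = u σ`, `Σ = V(w)` -/
  σ : Fin n
  /-- the exponent row: `e σ = S₀`, members' weights elsewhere -/
  e : Fin n → ℕ
  /-- the unit cofactor -/
  ε : R
  /-- it is a unit -/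
  isUnit : IsUnit ε

namespace Frame

variable {R : Type u} [CommRing R] [IsLocalRing R] (F : Frame R)

/-- The surface equation `w = u σ`. [folklore] -/
def w : R := F.u F.σ

/-- The residual order `S₀ = e σ`. [folklore] -/
def S₀ : ℕ := F.e F.σ

/-- The ideal of record `I = ε · u^e` (principal monomial in the frame). [folklore] -/
def ideal : R := F.ε * uPow F.u F.e

/-- The residual factor `N = ε · w^{S₀}`. [folklore] -/
def residual : R := F.ε * F.w ^ F.S₀

/-- The boundary monomial `M = ∏_{j ≠ σ} u_j^{e_j}` (the row with the surface slot zeroed). [folklore] -/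
def monomialPart : R := uPow F.u (Function.update F.e F.σ 0)

/-- `I = M · N`. [folklore] -/
theorem ideal_eq_monomialPart_mul_residual : F.ideal = F.monomialPart * F.residual := by
  unfold ideal residual monomialPart w S₀
  rw [uPow_eq_pow_mul_uPow_update_zero F.u F.e F.σ]
  ring

/-- [OURS · L1 W4.2] (G10a) TAME-SURFACE kind: `m ≤ S₀` (the surface `Σ` lies in `X_max`). [folklore] -/
def IsSurfaceKind (m : ℕ) : Prop := m ≤ F.S₀

/-- [OURS · L1 W4.2] (MID-α) kind: `1 ≤ S₀ < m` (the surface is a RAY of the exact board, never a centre alone). [folklore] -/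
def IsMidAlphaKind (m : ℕ) : Prop := 1 ≤ F.S₀ ∧ F.S₀ < m

/-- The three cases exhaust: EXACT residual (`S₀ = 0`, no surface slot content), (MID-α), or SURFACE. [folklore] -/
theorem kind_trichotomy (m : ℕ) : F.S₀ = 0 ∨ F.IsMidAlphaKind m ∨ F.IsSurfaceKind m := by
  unfold IsMidAlphaKind IsSurfaceKind
  omega

/-- The kinds are exclusive: surface vs mid-α. [folklore] -/
theorem not_isMidAlphaKind_of_isSurfaceKind {m : ℕ} (h : F.IsSurfaceKind m) : ¬ F.IsMidAlphaKind m := by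
  unfold IsMidAlphaKind IsSurfaceKind at *
  omega

/-! ## §3. (G10a) The surface step = the singleton face `{σ}` -/

/-- **`I ∈ (w)^i ↔ i ≤ S₀`** — the order of `I` along `Σ = V(w)` is `S₀` exactly (060's order dictionary at `T = {σ}`). [cite: CossartPiltant2019, Prop. 2.1 (arXiv v1 p. 10)] -/
theorem ideal_mem_span_w_pow_iff (i : ℕ) : F.ideal ∈ Ideal.span {F.w} ^ i ↔ i ≤ F.S₀ := by
  have h := unit_mul_uPow_mem_pow_span_image_iff F.isRsopPart F.isUnit {F.σ} F.e i
  simp only [Finset.coe_singleton, Set.image_singleton, Finset.sum_singleton] at h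
  exact h

/-- **(L1) reading: `Σ ⊆ X_max` (`I ∈ (w)^m`, the singleton face `{σ}` is LEGAL) iff the point is of SURFACE kind.** [folklore] -/
theorem ideal_mem_span_w_pow_iff_isSurfaceKind (m : ℕ) : F.ideal ∈ Ideal.span {F.w} ^ m ↔ F.IsSurfaceKind m :=
  F.ideal_mem_span_w_pow_iff m

/-- At a (MID-α) point the surface alone is NOT a legal centre. [folklore] -/
theorem not_ideal_mem_span_w_pow_of_isMidAlphaKind {m : ℕ} (h : F.IsMidAlphaKind m) : F.ideal ∉ Ideal.span {F.w} ^ m := by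
  rw [F.ideal_mem_span_w_pow_iff]
  unfold IsMidAlphaKind at h
  omega

/-- [OURS · L1 W4.2] **THE VALUE LAW of the surface step**: the new row `e′ = update e σ (S₀ − m)` — the surface `Σ` becomes the boundary member in slot `σ`
with weight `α_Σ = S₀ − m`, the other members keep their weights (RULING v3.14-48 (PC)(G10a) «`α_E = k − m`»). [folklore] -/
def surfaceRow (m : ℕ) : Fin F.n → ℕ := Function.update F.e F.σ (F.S₀ - m)

/-- The new member's weight. [folklore] -/
@[simp] theorem surfaceRow_σ (m : ℕ) : F.surfaceRow m F.σ = F.S₀ - m := by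
  simp [surfaceRow]

/-- Members keep their weights. [folklore] -/
theorem surfaceRow_of_ne (m : ℕ) {j : Fin F.n} (hj : j ≠ F.σ) : F.surfaceRow m j = F.e j := by
  simp [surfaceRow, hj]

/-- **The value law IS T-M1's `move` row** at the face `J = {σ}`, new slot `j₀ = σ`: `update e j₀ (Σ_{j∈J} e_j − m)`. [folklore] -/
theorem surfaceRow_eq_move (m : ℕ) : F.surfaceRow m = Function.update F.e F.σ (∑ j ∈ ({F.σ} : Finset (Fin F.n)), F.e j - m) := by
  rw [Finset.sum_singleton]
  rfl

/-- **(G10a) CONTROLLED TRANSFORM of the surface step, PROVED: `(I) = (w^m) · (u^{e′})`** in the SAME ring (the blow-up of the Cartier divisor `Σ` of the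
threefold germ is an isomorphism, chart map `= id`) — T-M1's `map_span_singleton_unit_mul_uPow` at `J = {σ}`, `j₀ = σ`. [cite: CossartPiltant2019, Prop. 2.6 (arXiv v1 p. 13)] -/
theorem span_ideal_eq_surfaceStep {m : ℕ} (hm : F.IsSurfaceKind m) :
    Ideal.span {F.ideal} = Ideal.span {F.w ^ m} * Ideal.span {uPow F.u (F.surfaceRow m)} := by
  have hle : m ≤ ∑ j ∈ ({F.σ} : Finset (Fin F.n)), F.e j := by rw [Finset.sum_singleton]; exact hm
  have h := map_span_singleton_unit_mul_uPow (RingHom.id R) F.u F.u (J := {F.σ}) (j₀ := F.σ) (Finset.mem_singleton_self _)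
    (fun j => by
      by_cases hj : j = F.σ
      · simp [hj]
      · simp [hj]) hle F.isUnit
  rw [Ideal.map_id] at h
  rw [surfaceRow_eq_move]
  exact h

/-- After the surface step the residual is the UNIT `ε`: `u^{e′} = u^{e′·𝟙_{≠σ}} · w^{S₀−m}` carries the old residual's power into the MEMBER slot, so the
new residual order is `0` — the point is EXACT (reading for o1's kind update). [folklore] -/
theorem residual_after_surfaceStep (m : ℕ) :
    uPow F.u (F.surfaceRow m) = F.w ^ (F.S₀ - m) * uPow F.u (Function.update (F.surfaceRow m) F.σ 0) := by
  rw [uPow_eq_pow_mul_uPow_update_zero F.u (F.surfaceRow m) F.σ, surfaceRow_σ]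
  rfl

/-- The monomial part is untouched by the surface step (only slot `σ` moves). [folklore] -/
theorem update_surfaceRow_zero (m : ℕ) : Function.update (F.surfaceRow m) F.σ 0 = Function.update F.e F.σ 0 := by
  unfold surfaceRow
  rw [Function.update_idem]

end Frame

/-! ## §2. The intrinsic form of the frame residual -/

section Intrinsic

variable {R : Type u} [CommRing R] [IsLocalRing R]

/-- **INTRINSIC FORM ⇒ FRAME RESIDUAL, PROVED** (RULING v3.14-49 (RA)/(RB-1)): if `w ∈ 𝔪`, `N ∈ (w^{S})` and `N ∉ 𝔪^{S+1}` (`ord N = S` at the point and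
`ord_Σ N ≥ S` along `Σ = V(w)`), then `N = ε · w^{S}` with `ε` a UNIT — the cofactor of `w^{S}` cannot lie in `𝔪`. [folklore] -/
theorem exists_isUnit_mul_pow_of_mem_span_pow {w N : R} {S : ℕ} (hw : w ∈ maximalIdeal R) (hN : N ∈ Ideal.span {w ^ S})
    (hord : N ∉ maximalIdeal R ^ (S + 1)) : ∃ ε : R, IsUnit ε ∧ N = ε * w ^ S := by
  obtain ⟨a, ha⟩ := Ideal.mem_span_singleton'.mp hN
  refine ⟨a, ?_, ha.symm⟩
  by_contra hna
  apply hord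
  have hmem : w ^ S * a ∈ maximalIdeal R ^ S * maximalIdeal R :=
    Ideal.mul_mem_mul (Ideal.pow_mem_pow hw S) ((mem_maximalIdeal a).mpr hna)
  rw [← ha, pow_succ, mul_comm a]
  exact hmem

omit [IsLocalRing R] in
/-- Conversely the frame residual lies in `(w^{S})` (trivially) — the non-membership `∉ 𝔪^{S+1}` is the frame's snc clause read through quasi-regularity and
is not restated here. [folklore] -/
theorem unit_mul_pow_mem_span_pow (ε w : R) (S : ℕ) : ε * w ^ S ∈ Ideal.span {w ^ S} :=
  Ideal.mul_mem_left _ ε (Ideal.mem_span_singleton_self _)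

end Intrinsic

/-! ## §4. (G10b) The 𝓑-regularisation sub-phase: the frame persists with the same `S₀` (READING AXIOM) -/

/-- [OURS · L1 W4.2] **READING AXIOM — (G10b) SURFACE-PHASE CHILD** (DESK WORD 18:37:40Z: centres = points / regular curves inside `Σ` prescribed by the
IMPORTED embedded sequence F-72/F-60 for `(Σ, E|_Σ)`; (L1) they lie in `X_max`, (L2) `X` is normally flat along them — 060's lemmas BY NAME —, (L3′) S-SAFETY:
at the lineage child on the strict transform `Σ′` the frame reading persists with the SAME `S₀`): the child frame `F′` (over the child germ `R′`) has
`F′.S₀ = F.S₀`, and the imported sequence's count of remaining centres drops. NOT a statement of the manuscript. [folklore] -/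
structure IsSurfacePhaseChild {R R' : Type u} [CommRing R] [IsLocalRing R] [CommRing R'] [IsLocalRing R'] (F : Frame R) (F' : Frame R')
    (β β' : ℕ) : Prop where
  /-- (L3′) the residual order along the surface persists -/
  S₀_eq : F'.S₀ = F.S₀
  /-- the remaining-centre count of the imported embedded sequence drops -/
  count_lt : β' < β

namespace IsSurfacePhaseChild

variable {R R' : Type u} [CommRing R] [IsLocalRing R] [CommRing R'] [IsLocalRing R'] {F : Frame R} {F' : Frame R'} {β β' : ℕ}
  (h : IsSurfacePhaseChild F F' β β')

include h

/-- The surface kind persists through the sub-phase (same `S₀`). [folklore] -/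
theorem isSurfaceKind_iff (m : ℕ) : F'.IsSurfaceKind m ↔ F.IsSurfaceKind m := by
  unfold Frame.IsSurfaceKind
  rw [h.S₀_eq]

/-- **The TAME-HIGH fuel's first coordinate drops in the sub-phase** (lex shape `ℕ ×ₗ (ℕ ×ₗ ℕ)` = 002's `TameHighFuel`: (remaining surface steps, thread
index, hits)). [folklore] -/
theorem fuel_lt (t t' k k' : ℕ) : toLex (β', toLex (t', k')) < (toLex (β, toLex (t, k)) : ℕ ×ₗ (ℕ ×ₗ ℕ)) :=
  Prod.Lex.toLex_lt_toLex.mpr (Or.inl h.count_lt)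

end IsSurfacePhaseChild

end Summit.ResolutionOfSingularities.ResolutionOfSingularities.Theorems.SigmaMaxModificationsCorridor3.Sigma.TameSurface
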